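import Summits.HubbardSuperconductivity.HubbardSuperconductivity.Theorems.AnisotropyChordTransferFibre3FinXBCNine
import Summits.HubbardSuperconductivity.HubbardSuperconductivity.Theorems.AnisotropyChordTransferFibre3FinXBCTen
import Summits.HubbardSuperconductivity.HubbardSuperconductivity.Theorems.AnisotropyChordTransferFibre3FinXBCEleven
import Summits.HubbardSuperconductivity.HubbardSuperconductivity.Theorems.AnisotropyChordTransferFibre3FinXBCTwelve
import Summits.HubbardSuperconductivity.HubbardSuperconductivity.Theorems.AnisotropyChordTransferFibre3FinXBCThirteen
import Summits.HubbardSuperconductivity.HubbardSuperconductivity.Theorems.AnisotropyChordTransferFibre3FinXBCFourteen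
import Summits.HubbardSuperconductivity.HubbardSuperconductivity.Theorems.AnisotropyChordTransferFibre3FinXBCFifteen
import Summits.HubbardSuperconductivity.HubbardSuperconductivity.Theorems.AnisotropyChordTransferFibre3FinXBCSixteen
import Summits.HubbardSuperconductivity.HubbardSuperconductivity.Theorems.AnisotropyChordTransferFibre3FinXBCSeventeen
import Summits.HubbardSuperconductivity.HubbardSuperconductivity.Theorems.AnisotropyChordTransferFibre3FinXBCEighteen
import Summits.HubbardSuperconductivity.HubbardSuperconductivity.Theorems.AnisotropyChordTransferFibre3FinXBCNineteen
import Summits.HubbardSuperconductivity.HubbardSuperconductivity.Theorems.AnisotropyChordTransferFibre3FinXC2Twenty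
import Summits.HubbardSuperconductivity.HubbardSuperconductivity.Theorems.AnisotropyChordTransferFibre3FinXC2TwentyOne
import Summits.HubbardSuperconductivity.HubbardSuperconductivity.Theorems.AnisotropyChordTransferFibre3FinXC2TwentyTwo
import Summits.HubbardSuperconductivity.HubbardSuperconductivity.Theorems.AnisotropyChordTransferFibre3FinXC2TwentyThree
import Summits.HubbardSuperconductivity.HubbardSuperconductivity.Theorems.AnisotropyChordTransferFibre3FinXC2TwentyFour

/-!
# Route `AnisotropyChord` / H0 rotor rung: ★★ ROW C (KT-2b″) FOR EVERY `9 ≤ L ≤ 24`, `0 < Δ ≤ 0.98` (FIN-class, kernel-certified)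

Packaging of the per-`L` combined (rows `N₁` + C) certificates: g5's `offPoleTailAbs_nine … twelve` (`…FinXBC<Word>`, `b = 29/20`,
`30/20`), g6's `offPoleTailAbs_thirteen … nineteen` (`…FinXBC<Word>`, g5 evaluator, `b ≤ 30/20`) and `offPoleTailAbs_twenty …
twentyfour` (`…FinXC2<Word>`, XBC2 evaluator, `b ≤ 32/20`) into ONE statement:
`offPoleTailAbs_of_le_24 : 9 ≤ L → L ≤ 24 → 0 < Δ → Δ ≤ 0.98 → ∃ b ≤ 8/5, OffPoleTailAbs L Δ b` (`interval_cases`; the per-`L` /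
per-cell constants `(cᵢ, bnᵢ/20)` remain available in `cellsC<L>` / `cellsC2_<L>`).  Row C per `L` for `L ≥ 25` is open (the exact-block
row-C layer exceeds the per-declaration kernel ceiling there, mechhunt STATUS p3 g6 REPORT 3); the strip `0.98 < Δ < 1` is ruling R3.
Prover seat `hubbard-h0-rotor-p3` g6; helper for piece A = stmt-HubbardSuperconductivity-23918 of rung 19089 (`--supports`, helper
class).  WHAT THIS IS NOT: nothing here proves superconductivity in the Hubbard model (rotor TARGET as worded stays FALSE, g15 verdict);
ONE hypothesis (row C) of ONE conditional reduction (`gm3_allL`) on a finite range of `L`.  Tree imports only; no sorry, no new axioms.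
-/

set_option linter.dupNamespace false
set_option autoImplicit false

namespace Summit.HubbardSuperconductivity.HubbardSuperconductivity.Theorems.AnisotropyChord.Transfer.Fibre3

/-- ★★ ROW C (KT-2b″) FOR EVERY `9 ≤ L ≤ 24`: some `b ≤ 8/5` with `OffPoleTailAbs L Δ b`, for every `0 < Δ ≤ 0.98` (FIN-class,
kernel-certified with zero data; 16 per-`L` combined certificates). [folklore] -/
theorem offPoleTailAbs_of_le_24 (L : ℕ) [NeZero L] (h9 : 9 ≤ L) (h24 : L ≤ 24) {Δ : ℝ} (hΔ0 : 0 < Δ) (hΔ1 : Δ ≤ 0.98) :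
    ∃ b : ℝ, OffPoleTailAbs L Δ b ∧ b ≤ 8 / 5 := by
  interval_cases L
  · exact ⟨_, offPoleTailAbs_nine hΔ0 hΔ1, by norm_num⟩
  · exact ⟨_, offPoleTailAbs_ten hΔ0 hΔ1, by norm_num⟩
  · exact ⟨_, offPoleTailAbs_eleven hΔ0 hΔ1, by norm_num⟩
  · exact ⟨_, offPoleTailAbs_twelve hΔ0 hΔ1, by norm_num⟩
  · exact ⟨_, offPoleTailAbs_thirteen hΔ0 hΔ1, by norm_num⟩
  · exact ⟨_, offPoleTailAbs_fourteen hΔ0 hΔ1, by norm_num⟩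
  · exact ⟨_, offPoleTailAbs_fifteen hΔ0 hΔ1, by norm_num⟩
  · exact ⟨_, offPoleTailAbs_sixteen hΔ0 hΔ1, by norm_num⟩
  · exact ⟨_, offPoleTailAbs_seventeen hΔ0 hΔ1, by norm_num⟩
  · exact ⟨_, offPoleTailAbs_eighteen hΔ0 hΔ1, by norm_num⟩
  · exact ⟨_, offPoleTailAbs_nineteen hΔ0 hΔ1, by norm_num⟩
  · exact ⟨_, offPoleTailAbs_twenty hΔ0 hΔ1, by norm_num⟩
  · exact ⟨_, offPoleTailAbs_twentyone hΔ0 hΔ1, by norm_num⟩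
  · exact ⟨_, offPoleTailAbs_twentytwo hΔ0 hΔ1, by norm_num⟩
  · exact ⟨_, offPoleTailAbs_twentythree hΔ0 hΔ1, by norm_num⟩
  · exact ⟨_, offPoleTailAbs_twentyfour hΔ0 hΔ1, by norm_num⟩

end Summit.HubbardSuperconductivity.HubbardSuperconductivity.Theorems.AnisotropyChord.Transfer.Fibre3
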